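import Summits.ValiantsHypothesis.ValiantsHypothesis.Theses.RigidMinimalReps
import Summits.ValiantsHypothesis.ValiantsHypothesis.Theorems.RigidMinimalRepsOrbitsForceTorusAction
import Summits.ValiantsHypothesis.ValiantsHypothesis.Theorems.RigidMinimalRepsMinimalRepTorusSymmetricStubInitialForm
import Summits.ValiantsHypothesis.ValiantsHypothesis.Theorems.RigidMinimalRepsMinimalRepTorusSymmetricStubTightLifts
import Literature.Computability.AlgebraicComplexity.DetReprEquivalent

/-!
# Crux `RigidMinimalReps.MinimalRepTorusSymmetric` (stmt-ValiantsHypothesis-5112), line `birth` —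
# the reduction: a two-sided SUB-POTENTIAL on some optimal representation gives the crux

`X = MinimalRepTorusSymmetric` ("for all large `n`, `per_n` has an affine determinantal representation
of size exactly `dc(per_n)` with exact `GL_s × GL_s`-lifts of every two-sided torus substitution
`x_{kl} ↦ d_k e_l x_{kl}`") follows from its COMBINATORIAL SHADOW, the statement of the line's
remaining stub `stub_subPotentials`: for all large `n`, at `s = dc(per_n)`, SOME affine determinantal
representation `A` of `per_n` of size `s` admits row/column potentials
`α, β : Fin s → (Fin n → ℤ) × (Fin n → ℤ)` with `Λ_{ij} ≠ 0 ⇒ α i + β j ≤ 0`,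
`(A_{kl})_{ij} ≠ 0 ⇒ α i + β j ≤ (e_k, e_l)` and `Σ α + Σ β = 𝟙` (no bottom cancellation along the
`2n` coordinate one-parameter subgroups of the torus; by König–Egerváry duality: for every row `k`
(column `l`) of the permanent every perfect matching of the support pattern of `A` uses an entry made of
row-`k` (column-`l`) variables only).

Proof = the composition of the line with its two landed stubs: the initial form of `A` along `α, β`
is a TIGHT optimal representation `A'` (`stub_initialForm`, the Białynicki-Birula sink of the gauge
class); a tight matrix has diagonal exact lifts of the generators `diag(d) ⊗ diag(e)`
(`stub_tightLifts`); exact lifts are closed under the group operations (`lifts_one/mul/inv`), so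
`Subgroup.closure_induction` and `isEquivariantDetRepr_iff_exists_mul_mul` give
`HasEquivariantDetRepr Γ_T per_n (dc per_n)`.

This file records the reduction as a tree theorem (`--supports stmt-ValiantsHypothesis-5112`); the
hypothesis is stated inline (it is the registered stub's signature verbatim), not as a named fact.
[cite: LandsbergRessayre2017, Def. 1.3, §2.1] [cite: Bialynickibirula1973, Thm. 4.1]
-/

-- Sub = Summit single-conjunct layout: the duplicated namespace component is mandated by the tree.
set_option linter.dupNamespace false

noncomputable section

namespace Summit.ValiantsHypothesis.ValiantsHypothesis.Theorems.RigidMinimalRepsMinimalRepTorusSymmetric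

open Matrix MvPolynomial Finset
open Literature.Computability.AlgebraicComplexity LRPencil
open Summit.ValiantsHypothesis.ValiantsHypothesis.Theorems.RigidMinimalRepsOrbitsForceTorus

/-- **The crux from a sub-potential** (line `birth`, composition with the landed stubs
`stub_initialForm` and `stub_tightLifts`): if for all large `n` some optimal affine determinantal
representation of `per_n` admits a two-sided sub-potential `α, β` (inequalities on the support,
`Σ α + Σ β = 𝟙`), then for all large `n` some optimal representation is equivariant for the whole
two-sided torus `x_{kl} ↦ d_k e_l x_{kl}` — the crux `MinimalRepTorusSymmetric` BY NAME.
[cite: LandsbergRessayre2017, Def. 1.3, §2.1] -/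
theorem minimalRepTorusSymmetric_of_subPotentials :
    (∃ n₀ : ℕ, ∀ n ≥ n₀, ∀ s : ℕ, determinantalComplexity (perPoly (Fin n) ℂ) = s →
      ∃ A : Matrix (Fin s) (Fin s) (MvPolynomial (Fin n × Fin n) ℂ),
        IsAffineDetRepr (perPoly (Fin n) ℂ) A ∧
        ∃ α β : Fin s → (Fin n → ℤ) × (Fin n → ℤ),
          (∀ i j, constPart A i j ≠ 0 → α i + β j ≤ 0) ∧
          (∀ i j (v : Fin n × Fin n), coeffMat A v i j ≠ 0 →
            α i + β j ≤ ((Pi.single v.1 1 : Fin n → ℤ), (Pi.single v.2 1 : Fin n → ℤ))) ∧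
          ∑ i, α i + ∑ j, β j = 1) →
    Summit.ValiantsHypothesis.ValiantsHypothesis.Theses.RigidMinimalReps.MinimalRepTorusSymmetric := by
  intro h
  unfold Summit.ValiantsHypothesis.ValiantsHypothesis.Theses.RigidMinimalReps.MinimalRepTorusSymmetric
  classical
  obtain ⟨n₀, hn₀⟩ := h
  refine ⟨n₀, fun n hn => ?_⟩
  -- work at a fixed size `s = dc(per_n)` (generalised, to keep `dc` opaque)
  obtain ⟨s, hs⟩ : ∃ s : ℕ, determinantalComplexity (perPoly (Fin n) ℂ) = s := ⟨_, rfl⟩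
  rw [hs]
  -- (1) an optimal representation `A` with a two-sided sub-potential `α, β`
  obtain ⟨A, hA, α, β, hP₀, hP₁, hsum⟩ := hn₀ n hn s hs
  -- (2) its initial form `A'` is again an optimal representation, now TIGHT for `α, β`
  obtain ⟨A', hA', -, hT₀, hT₁⟩ := stub_initialForm n s A α β hA hP₀ hP₁ hsum
  -- (3) diagonal lifts of the generators + closure under the group operations
  refine ⟨A', isEquivariantDetRepr_iff_exists_mul_mul.2 ⟨hA', fun γ hγ => ?_⟩⟩
  induction hγ using Subgroup.closure_induction with
  | one => exact lifts_one A'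
  | mul x y _ _ hx hy => exact lifts_mul hx hy
  | inv x _ hx => exact lifts_inv hx
  | mem γ hγ =>
    obtain ⟨d, e, hd, he, hγe⟩ := hγ
    obtain ⟨P, Q, hPQ⟩ := stub_tightLifts n s A' α β hA'.1 hT₀ hT₁ d e hd he
    refine ⟨P, Q, ?_⟩
    show A'.map (linSubst (Fin n × Fin n) ℂ (γ : Matrix (Fin n × Fin n) (Fin n × Fin n) ℂ)) = _
    rw [hγe]
    exact hPQ

end Summit.ValiantsHypothesis.ValiantsHypothesis.Theorems.RigidMinimalRepsMinimalRepTorusSymmetric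

end
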